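import Summits.QuantumFields.YangMills.Theorems.ParabolicTrajectoryTunedSequenceExistsPairCeiling

/-!
# `TunedSequenceExists` (stmt-QuantumFields-10524), line `fixed-aspect-window`:
# the INFRARED corner of both mirror stubs from the sibling crux `LatticeGapInUVUnitsC`

Stub `stub_mirrorBoundOut` (= `FixedAspectSplit.MirrorBoundOutAll`: `D⁸ |⟨Pᴿ ; τ_D P⟩_{β,2L+1}| ≤ K` for ALL
`β ≥ β₁`, all tori `2L+1`, all `D ≤ L`, `P = r.curvature.F` the corner action density, `Pᴿ = P ∘ cfgReflect` its
time mirror) is open-problem class as registered.  Regime map: FEMTO tori `(2L+1)·a(β) ≤ ℓ₀` are covered by the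
sibling crux `FemtoCurvatureTwoPointC` (`PairCeiling.mirrorBounds_femto_of_femtoCurvatureTwoPointC`); this file
covers the INFRARED corner: separations `a(β)·D ≥ R·(1 + |log a(β)|)` on tori `L ≥ S₁(β)`, `β ≥ β₂`, from the
sibling crux `Theses.LangevinControlUV.LatticeGapInUVUnitsC` (stmt-QuantumFields-16206: volume-uniform
clustering `|⟨A ; τ_n B⟩_{β,2S+1}| ≤ C_{AB}·e^{−c₁ a(β) n}` of all gauge-invariant local pairs, for EVERY continuous
unit map `a` carrying the femto package — so the units are shared with the femto corner).  The crossover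
(`(2L+1)·a(β) > ℓ₀` and `a(β)·D < R·(1 + |log a(β)|)` or `L < S₁(β)`) is covered by neither sibling.

Proved here (`--supports stmt-QuantumFields-10524`, no new hypotheses beyond the two sibling cruxes taken as
named hypotheses):
* `pow_eight_mul_exp_neg_le_one` — the real-analysis core: for `c₁ > 0` there is `R > 0` with
  `D⁸ · e^{−c₁ a D} ≤ 1` whenever `a > 0` and `a·D ≥ R·(1 + |log a|)`;
* `mirrorBounds_infrared_of_clustering` — at fixed `(G, r, a)`: the clustering conclusion of the gap crux in
  units `a` gives `β₂, R > 0, K ≥ 0, S₁` with all three canonical ceilings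
  `D⁸ |⟨P ; τ_D Pᴿ⟩|, D⁸ |⟨Pᴿ ; τ_D P⟩|, D⁸ |⟨P ; τ_D P⟩| ≤ K` on `β ≥ β₂`, `S₁ β ≤ L`, `D ≤ L`,
  `R·(1 + |log (a β)|) ≤ a β · D`;
* `mirrorBounds_infrared_of_gapC_at` — the same for every compact simple `G`, every `r` and EVERY continuous unit
  map `a` carrying the femto package, from `LatticeGapInUVUnitsC` alone;
* `mirrorBounds_infrared_of_gapC` — from `FemtoCurvatureTwoPointC ∧ LatticeGapInUVUnitsC`: some continuous unit
  map `a > 0`, `a → 0` (the one of the femto crux) with the three infrared ceilings.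
References: Osterwalder–Seiler 1978 §2 (torus Wilson states, time reflection).
-/

noncomputable section

open Filter Topology MeasureTheory
open Literature.MathematicalPhysics.QuantumFieldTheory hiding Site ZdEdge
open Literature.MathematicalPhysics.QuantumLattice
open Summit.QuantumFields.YangMills.Theorems.FiniteSusceptibilityWeakCoupling.MirrorDominationAxis0 (reflSpecies)

namespace Summit.QuantumFields.YangMills.Theorems.TunedSequenceExists.MirrorInfrared

/-! ## The real-analysis core -/

section Core

/-- **Real-analysis core of the infrared corner.** For `c₁ > 0` there is `R > 0` such that
`D⁸ · e^{−c₁ a D} ≤ 1` for every `a > 0` and every `D : ℕ` with `R·(1 + |log a|) ≤ a·D`.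
(With `y := a D`: `8 log D = 8 log y − 8 log a ≤ (c₁/4) y + M + 8 |log a| ≤ c₁ y` once
`c₁ y ≥ (16 + 4M)(1 + |log a|)`, `M := 8 + 8 |log (c₁/32)|` from `log t ≤ t − 1` at `t = c₁ y / 32`.) [folklore] -/
theorem pow_eight_mul_exp_neg_le_one {c₁ : ℝ} (hc₁ : 0 < c₁) :
    ∃ R : ℝ, 0 < R ∧ ∀ (a : ℝ), 0 < a → ∀ (D : ℕ), R * (1 + |Real.log a|) ≤ a * D →
      (D : ℝ) ^ 8 * Real.exp (-(c₁ * a * D)) ≤ 1 := by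
  set M : ℝ := 8 + 8 * |Real.log (c₁ / 32)| with hM
  have hM0 : 0 ≤ M := by positivity
  refine ⟨(16 + 4 * M) / c₁, by positivity, fun a ha D hD => ?_⟩
  rcases Nat.eq_zero_or_pos D with rfl | hDpos
  · simp
  have hD0 : (0 : ℝ) < D := by exact_mod_cast hDpos
  have hy0 : 0 < a * D := mul_pos ha hD0
  -- (1) `8 log (a D) ≤ (c₁/4) (a D) + M - 16`
  have h1 : 8 * Real.log (a * D) ≤ c₁ / 4 * (a * D) + M - 16 := by
    have h := Real.log_le_sub_one_of_pos (show 0 < c₁ / 32 * (a * D) by positivity)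
    rw [Real.log_mul (by positivity) hy0.ne'] at h
    have habs : -Real.log (c₁ / 32) ≤ |Real.log (c₁ / 32)| := neg_le_abs _
    rw [hM]
    linarith
  -- (2) the threshold, multiplied by `c₁`
  have h2 : (16 + 4 * M) * (1 + |Real.log a|) ≤ c₁ * (a * D) := by
    have := mul_le_mul_of_nonneg_left hD hc₁.le
    rwa [← mul_assoc, mul_div_cancel₀ _ hc₁.ne'] at this
  have hla : 0 ≤ |Real.log a| := abs_nonneg _
  have hMl : 0 ≤ M * |Real.log a| := mul_nonneg hM0 hla
  have hnla : -Real.log a ≤ |Real.log a| := neg_le_abs _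
  -- (3) `8 log D ≤ c₁ a D`
  have h3 : 8 * Real.log D ≤ c₁ * a * D := by
    have hlogD : Real.log D = Real.log (a * D) - Real.log a := by
      rw [Real.log_mul ha.ne' hD0.ne']; ring
    rw [hlogD]
    nlinarith
  -- conclusion
  have h4 : (D : ℝ) ^ 8 ≤ Real.exp (c₁ * a * D) := by
    rw [← Real.log_le_iff_le_exp (by positivity), Real.log_pow]
    push_cast
    linarith
  rw [Real.exp_neg, ← div_eq_mul_inv, div_le_one (Real.exp_pos _)]
  exact h4

end Core

/-! ## The infrared corner at fixed data -/

section Fixed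

variable {G : Type} [Group G] [TopologicalSpace G] [IsTopologicalGroup G] [CompactSpace G]
  [MeasurableSpace G] [BorelSpace G]

/-- **The infrared corner of the mirror stubs from clustering in units `a`** (fixed `G`, `r`, `a > 0`).  If all
gauge-invariant local pairs cluster at rate `c₁ a(β)` on tori `2S+1 ≥ 2S₁(β)+1` for `β ≥ β₂` (the conclusion of
`LatticeGapInUVUnitsC` at `(G, r, a)`), then with `R = R(c₁)` of `pow_eight_mul_exp_neg_le_one` and
`K = max 0 (max C₁ (max C₂ C₃))` (the clustering constants of the pairs `(P, Pᴿ)`, `(Pᴿ, P)`, `(P, P)`,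
`Pᴿ = reflSpecies P`): all three canonical ceilings `D⁸ |⟨P ; τ_D Pᴿ⟩|, D⁸ |⟨Pᴿ ; τ_D P⟩|, D⁸ |⟨P ; τ_D P⟩| ≤ K`
hold for `β ≥ β₂`, `S₁ β ≤ L`, `D ≤ L`, `R·(1 + |log (a β)|) ≤ a β · D`. [cite: OsterwalderSeiler1978, §2] -/
theorem mirrorBounds_infrared_of_clustering (r : LatticeRep G) {a : ℝ → ℝ} (hapos : ∀ β, 0 < a β)
    (hgap : ∃ (c₁ β₂ : ℝ) (S₁ : ℝ → ℕ), 0 < c₁ ∧ ∀ A B : YMSpecies G, ∃ C : ℝ, ∀ β : ℝ, β₂ ≤ β →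
      ∀ S n : ℕ, S₁ β ≤ S → n ≤ S →
        |latticeConnectedCorr r.ρ β (2 * S + 1) A.F B.F n| ≤ C * Real.exp (-(c₁ * a β * n))) :
    ∃ (β₂ R K : ℝ) (S₁ : ℝ → ℕ), 0 < R ∧ 0 ≤ K ∧
      ∀ β : ℝ, β₂ ≤ β → ∀ (L D : ℕ), S₁ β ≤ L → D ≤ L → R * (1 + |Real.log (a β)|) ≤ a β * D →
        (D : ℝ) ^ 8 * |latticeConnectedCorr r.ρ β (2 * L + 1) r.curvature.F
          (fun V => r.curvature.F (cfgReflect V)) D| ≤ K ∧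
        (D : ℝ) ^ 8 * |latticeConnectedCorr r.ρ β (2 * L + 1)
          (fun V => r.curvature.F (cfgReflect V)) r.curvature.F D| ≤ K ∧
        (D : ℝ) ^ 8 * |latticeConnectedCorr r.ρ β (2 * L + 1) r.curvature.F r.curvature.F D| ≤ K := by
  obtain ⟨c₁, β₂, S₁, hc₁, hAB⟩ := hgap
  obtain ⟨C₁, hC₁⟩ := hAB r.curvature (reflSpecies r.curvature)
  obtain ⟨C₂, hC₂⟩ := hAB (reflSpecies r.curvature) r.curvature
  obtain ⟨C₃, hC₃⟩ := hAB r.curvature r.curvature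
  obtain ⟨R, hR, hcore⟩ := pow_eight_mul_exp_neg_le_one hc₁
  refine ⟨β₂, R, max 0 (max C₁ (max C₂ C₃)), S₁, hR, le_max_left _ _, fun β hβ L D hL hDL hIR => ?_⟩
  have hexp : (D : ℝ) ^ 8 * Real.exp (-(c₁ * a β * D)) ≤ 1 := hcore (a β) (hapos β) D hIR
  -- one step for all three pairs
  have key : ∀ {x C : ℝ}, |x| ≤ C * Real.exp (-(c₁ * a β * D)) → C ≤ max 0 (max C₁ (max C₂ C₃)) →
      (D : ℝ) ^ 8 * |x| ≤ max 0 (max C₁ (max C₂ C₃)) := by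
    intro x C hx hC
    have hK0 : 0 ≤ max 0 (max C₁ (max C₂ C₃)) := le_max_left _ _
    calc (D : ℝ) ^ 8 * |x| ≤ (D : ℝ) ^ 8 * (C * Real.exp (-(c₁ * a β * D))) :=
          mul_le_mul_of_nonneg_left hx (by positivity)
      _ ≤ (D : ℝ) ^ 8 * (max 0 (max C₁ (max C₂ C₃)) * Real.exp (-(c₁ * a β * D))) :=
          mul_le_mul_of_nonneg_left (mul_le_mul_of_nonneg_right hC (Real.exp_pos _).le) (by positivity)
      _ = max 0 (max C₁ (max C₂ C₃)) * ((D : ℝ) ^ 8 * Real.exp (-(c₁ * a β * D))) := by ring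
      _ ≤ max 0 (max C₁ (max C₂ C₃)) * 1 := mul_le_mul_of_nonneg_left hexp hK0
      _ = max 0 (max C₁ (max C₂ C₃)) := mul_one _
  exact ⟨key (hC₁ β hβ L D hL hDL) (le_max_of_le_right (le_max_left _ _)),
    key (hC₂ β hβ L D hL hDL) (le_max_of_le_right (le_max_of_le_right (le_max_left _ _))),
    key (hC₃ β hβ L D hL hDL) (le_max_of_le_right (le_max_of_le_right (le_max_right _ _)))⟩

end Fixed

/-! ## The infrared corner from the sibling cruxes -/

/-- **The infrared corner from `LatticeGapInUVUnitsC` alone, in ANY admissible units.** For every compact simple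
`G`, every `r` and EVERY continuous unit map `a` carrying the femto two-point package (the hypothesis of the gap
crux, verbatim), there are `β₂`, `R > 0`, `K ≥ 0`, `S₁` with the three canonical infrared ceilings of
`mirrorBounds_infrared_of_clustering` in units `a`.  (So the femto corner and the infrared corner can be read in
the same units.) [cite: OsterwalderSeiler1978, §2] -/
theorem mirrorBounds_infrared_of_gapC_at
    (hGap : Summit.QuantumFields.YangMills.Theses.LangevinControlUV.LatticeGapInUVUnitsC) :
    ∀ (G : Type) [Group G] [TopologicalSpace G] [IsTopologicalGroup G] [CompactSpace G],
      IsCompactSimpleLieGroup G → letI : MeasurableSpace G := borel G; haveI : BorelSpace G := ⟨rfl⟩;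
      ∀ (r : LatticeRep G) (a : ℝ → ℝ), Continuous a →
      (∃ (Γ : ℝ → ℝ) (β₀ ℓ₀ c C : ℝ), 0 < ℓ₀ ∧ 0 < c ∧ (∀ β, 0 < a β) ∧
        Filter.Tendsto a Filter.atTop (nhds 0) ∧ (∀ s : ℝ, 0 < s → s ≤ ℓ₀ → 0 < Γ s ∧ Γ s ≤ 1) ∧
        ∀ (L : ℕ) [NeZero L] (β : ℝ), β₀ ≤ β → (L : ℝ) * a β ≤ ℓ₀ →
          let P : (Fin 4 → ZMod L) → Fin 4 → Fin 4 → GaugeConfig 4 L G → ℝ :=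
            fun x i j U => (r.N : ℝ) - (r.ρ (plaquetteHolonomy U x i j)).trace.re
          let E : (GaugeConfig 4 L G → ℝ) → ℝ := fun F => wilsonExpectation (d := 4) (L := L) r.ρ β F
          let cov : (GaugeConfig 4 L G → ℝ) → (GaugeConfig 4 L G → ℝ) → ℝ :=
            fun F F' => E (fun U => F U * F' U) - E F * E F'
          let dist : (Fin 4 → ZMod L) → (Fin 4 → ZMod L) → ℝ :=
            fun x y => Real.sqrt (∑ k : Fin 4, (((x k - y k).valMinAbs : ℤ) : ℝ) ^ 2)
          (∀ n : ℕ, 1 ≤ n → 8 * n ≤ L →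
              c * Γ ((n : ℝ) * a β) ≤
                (n : ℝ) ^ 8 * cov (P 0 0 1) (P (Pi.single (2 : Fin 4) ((n : ℕ) : ZMod L)) 0 1) ∧
              (n : ℝ) ^ 8 * cov (P 0 0 1) (P (Pi.single (2 : Fin 4) ((n : ℕ) : ZMod L)) 0 1) ≤
                C * Γ ((n : ℝ) * a β)) ∧
          (∀ (x y : Fin 4 → ZMod L) (i j i' j' : Fin 4), x ≠ y → i ≠ j → i' ≠ j' →
              |cov (P x i j) (P y i' j')| * dist x y ^ 8 ≤ C * Γ (dist x y * a β))) →
    ∃ (β₂ R K : ℝ) (S₁ : ℝ → ℕ), 0 < R ∧ 0 ≤ K ∧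
      ∀ β : ℝ, β₂ ≤ β → ∀ (L D : ℕ), S₁ β ≤ L → D ≤ L → R * (1 + |Real.log (a β)|) ≤ a β * D →
        (D : ℝ) ^ 8 * |latticeConnectedCorr r.ρ β (2 * L + 1) r.curvature.F
          (fun V => r.curvature.F (cfgReflect V)) D| ≤ K ∧
        (D : ℝ) ^ 8 * |latticeConnectedCorr r.ρ β (2 * L + 1)
          (fun V => r.curvature.F (cfgReflect V)) r.curvature.F D| ≤ K ∧
        (D : ℝ) ^ 8 * |latticeConnectedCorr r.ρ β (2 * L + 1) r.curvature.F r.curvature.F D| ≤ K := by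
  intro G _ _ _ _ hG
  letI : MeasurableSpace G := borel G
  haveI : BorelSpace G := ⟨rfl⟩
  intro r a ha hpkg
  obtain ⟨_, _, _, _, _, -, -, hapos, -⟩ := id hpkg
  exact mirrorBounds_infrared_of_clustering r hapos (hGap G hG r a ha hpkg)

/-- **The infrared corner of both mirror stubs (and of the diagonal `⟨P ; τ_D P⟩`) modulo the sibling cruxes
`FemtoCurvatureTwoPointC` (stmt-QuantumFields-16204) and `LatticeGapInUVUnitsC` (stmt-QuantumFields-16206).**
For every compact simple `G` and every `r` there are a CONTINUOUS unit map `a > 0`, `a → 0` (the one of the femto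
crux), `β₂`, an infrared threshold `R > 0`, `K ≥ 0` and a torus floor `S₁` such that for `β ≥ β₂`, all tori
`2L+1` with `S₁ β ≤ L`, all `D ≤ L` beyond the infrared threshold `R·(1 + |log (a β)|) ≤ a β · D`:
`D⁸ |⟨P ; τ_D Pᴿ⟩_{β,2L+1}| ≤ K`, `D⁸ |⟨Pᴿ ; τ_D P⟩_{β,2L+1}| ≤ K`, `D⁸ |⟨P ; τ_D P⟩_{β,2L+1}| ≤ K`.
What the registered stubs (A_in)/(A_out) assert BEYOND this and the femto corner is the crossover.
[cite: OsterwalderSeiler1978, §2] -/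
theorem mirrorBounds_infrared_of_gapC
    (hF : Summit.QuantumFields.YangMills.Theses.LangevinControlUV.FemtoCurvatureTwoPointC)
    (hGap : Summit.QuantumFields.YangMills.Theses.LangevinControlUV.LatticeGapInUVUnitsC) :
    ∀ (G : Type) [Group G] [TopologicalSpace G] [IsTopologicalGroup G] [CompactSpace G],
      IsCompactSimpleLieGroup G → letI : MeasurableSpace G := borel G; haveI : BorelSpace G := ⟨rfl⟩;
      ∀ (r : LatticeRep G),
    ∃ (a : ℝ → ℝ) (β₂ R K : ℝ) (S₁ : ℝ → ℕ), Continuous a ∧ (∀ β, 0 < a β) ∧ Tendsto a atTop (𝓝 0) ∧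
      0 < R ∧ 0 ≤ K ∧
      ∀ β : ℝ, β₂ ≤ β → ∀ (L D : ℕ), S₁ β ≤ L → D ≤ L → R * (1 + |Real.log (a β)|) ≤ a β * D →
        (D : ℝ) ^ 8 * |latticeConnectedCorr r.ρ β (2 * L + 1) r.curvature.F
          (fun V => r.curvature.F (cfgReflect V)) D| ≤ K ∧
        (D : ℝ) ^ 8 * |latticeConnectedCorr r.ρ β (2 * L + 1)
          (fun V => r.curvature.F (cfgReflect V)) r.curvature.F D| ≤ K ∧
        (D : ℝ) ^ 8 * |latticeConnectedCorr r.ρ β (2 * L + 1) r.curvature.F r.curvature.F D| ≤ K := by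
  intro G _ _ _ _ hG
  letI : MeasurableSpace G := borel G
  haveI : BorelSpace G := ⟨rfl⟩
  intro r
  obtain ⟨a, ha, hpkg⟩ := hF G hG r
  obtain ⟨_, _, _, _, _, -, -, hapos, hatend, -⟩ := id hpkg
  obtain ⟨β₂, R, K, S₁, hR, hK, h⟩ :=
    mirrorBounds_infrared_of_clustering r hapos (hGap G hG r a ha hpkg)
  exact ⟨a, β₂, R, K, S₁, ha, hapos, hatend, hR, hK, h⟩

/-! ## Femto and infrared corners in the SAME units: what remains is the crossover -/

/-- **Both corners in one unit map.** From `FemtoCurvatureTwoPointC ∧ LatticeGapInUVUnitsC`: for every compact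
simple `G` and every `r` there are ONE continuous unit map `a > 0`, `a → 0`, a femto radius `ℓ₀ > 0`, `β₃`, an
infrared threshold `R > 0`, `K ≥ 0` and a torus floor `S₁` such that for `β ≥ β₃`, all `L`, all `D ≤ L`, in EITHER
regime — femto torus `(2L+1)·a β ≤ ℓ₀`, or infrared separation `S₁ β ≤ L ∧ R·(1 + |log (a β)|) ≤ a β · D` — both
canonical mirror ceilings hold: `D⁸ |⟨P ; τ_D Pᴿ⟩_{β,2L+1}| ≤ K` and `D⁸ |⟨Pᴿ ; τ_D P⟩_{β,2L+1}| ≤ K`.  The femto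
regime is `PairCeiling.pow_mul_abs_mirrorIn_le/Out_le` on the pair ceiling read off clause 3 of the package at
`a` (adapted from `PairCeiling.mirrorBounds_femto_of_cruxCAt`, here at the GIVEN `a`); the infrared regime is
`mirrorBounds_infrared_of_clustering`.  The registered stubs (A_in)/(A_out) are exactly this with the regime
hypothesis dropped: the complement (crossover) is their open content. [cite: OsterwalderSeiler1978, §2] -/
theorem mirrorBounds_femto_and_infrared_of_gapC
    (hF : Summit.QuantumFields.YangMills.Theses.LangevinControlUV.FemtoCurvatureTwoPointC)
    (hGap : Summit.QuantumFields.YangMills.Theses.LangevinControlUV.LatticeGapInUVUnitsC) :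
    ∀ (G : Type) [Group G] [TopologicalSpace G] [IsTopologicalGroup G] [CompactSpace G],
      IsCompactSimpleLieGroup G → letI : MeasurableSpace G := borel G; haveI : BorelSpace G := ⟨rfl⟩;
      ∀ (r : LatticeRep G),
    ∃ (a : ℝ → ℝ) (ℓ₀ β₃ R K : ℝ) (S₁ : ℝ → ℕ), Continuous a ∧ (∀ β, 0 < a β) ∧ Tendsto a atTop (𝓝 0) ∧
      0 < ℓ₀ ∧ 0 < R ∧ 0 ≤ K ∧
      ∀ β : ℝ, β₃ ≤ β → ∀ (L D : ℕ), D ≤ L →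
        (((2 * L + 1 : ℕ) : ℝ) * a β ≤ ℓ₀ ∨ (S₁ β ≤ L ∧ R * (1 + |Real.log (a β)|) ≤ a β * D)) →
        (D : ℝ) ^ 8 * |latticeConnectedCorr r.ρ β (2 * L + 1) r.curvature.F
          (fun V => r.curvature.F (cfgReflect V)) D| ≤ K ∧
        (D : ℝ) ^ 8 * |latticeConnectedCorr r.ρ β (2 * L + 1)
          (fun V => r.curvature.F (cfgReflect V)) r.curvature.F D| ≤ K := by
  intro G _ _ _ _ hG
  letI : MeasurableSpace G := borel G
  haveI : BorelSpace G := ⟨rfl⟩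
  intro r
  obtain ⟨a, ha, hpkg⟩ := hF G hG r
  obtain ⟨Γ, β₀, ℓ₀, c, C, hℓ₀, -, hapos, hatend, hΓ, hall⟩ := id hpkg
  -- the infrared corner in units `a`
  obtain ⟨β₂, R, K, S₁, hR, hK, hIRc⟩ :=
    mirrorBounds_infrared_of_clustering r hapos (hGap G hG r a ha hpkg)
  -- the pair ceiling on every femto torus in units `a`, constant `max C 0`
  -- adapted from PairCeiling.mirrorBounds_femto_of_cruxCAt (same lines, at the given unit map)
  have hpair : ∀ (β : ℝ) (L : ℕ), β₀ ≤ β → ((2 * L + 1 : ℕ) : ℝ) * a β ≤ ℓ₀ →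
      PairCeiling.PairCeilingAt r β L (max C 0) := by
    intro β L hβ hfem x y i j i' j' hxy hij hij'
    have h3 := (hall (2 * L + 1) β hβ hfem).2 x y i j i' j' hxy hij hij'
    have hdpos := PairCeiling.torusDist_pos L hxy
    have hdle := PairCeiling.torusDist_le L x y
    have hs1 : 0 < Real.sqrt (∑ k : Fin 4, (((x k - y k).valMinAbs : ℤ) : ℝ) ^ 2) * a β :=
      mul_pos hdpos (hapos β)
    have hs2 : Real.sqrt (∑ k : Fin 4, (((x k - y k).valMinAbs : ℤ) : ℝ) ^ 2) * a β ≤ ℓ₀ :=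
      (mul_le_mul_of_nonneg_right hdle (hapos β).le).trans hfem
    have hΓ1 := (hΓ _ hs1 hs2).2
    have hΓ0 := (hΓ _ hs1 hs2).1
    refine h3.trans ?_
    calc C * Γ (Real.sqrt (∑ k : Fin 4, (((x k - y k).valMinAbs : ℤ) : ℝ) ^ 2) * a β)
        ≤ max C 0 * Γ (Real.sqrt (∑ k : Fin 4, (((x k - y k).valMinAbs : ℤ) : ℝ) ^ 2) * a β) :=
          mul_le_mul_of_nonneg_right (le_max_left _ _) hΓ0.le
      _ ≤ max C 0 * 1 := mul_le_mul_of_nonneg_left hΓ1 (le_max_right _ _)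
      _ = max C 0 := mul_one _
  obtain ⟨CP, hCP⟩ := r.curvature.bounded
  refine ⟨a, ℓ₀, max β₀ β₂, R, max K (max (2 * (CP * CP)) (36 * 2 ^ 8 * max C 0)), S₁, ha, hapos,
    hatend, hℓ₀, hR, le_max_of_le_left hK, fun β hβ L D hDL hreg => ?_⟩
  have hβ₀ : β₀ ≤ β := (le_max_left _ _).trans hβ
  have hβ₂ : β₂ ≤ β := (le_max_right _ _).trans hβ
  rcases hreg with hfem | ⟨hL, hIR⟩
  · -- femto corner
    rcases lt_or_ge D 2 with hD2 | hD2
    · -- `D ≤ 1`: the a priori bound `|⟨A ; B⟩| ≤ 2 C_A C_B`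
      have hD : (D : ℝ) ^ 8 ≤ 1 :=
        pow_le_one₀ (Nat.cast_nonneg _) (by exact_mod_cast (by omega : D ≤ 1))
      have hCC : 0 ≤ 2 * (CP * CP) := by nlinarith
      constructor
      · refine le_trans ?_ ((le_max_left _ _).trans (le_max_right _ _))
        have hcorr := WilsonBlockHeatBath.abs_latticeConnectedCorr_le_two_mul r β (2 * L + 1)
          (A := r.curvature.F) (B := fun V => r.curvature.F (cfgReflect V)) hCP (fun V => hCP _) D
        calc (D : ℝ) ^ 8 * |latticeConnectedCorr r.ρ β (2 * L + 1) r.curvature.F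
              (fun V => r.curvature.F (cfgReflect V)) D|
            ≤ 1 * (2 * (CP * CP)) := mul_le_mul hD hcorr (abs_nonneg _) zero_le_one
          _ = 2 * (CP * CP) := one_mul _
      · refine le_trans ?_ ((le_max_left _ _).trans (le_max_right _ _))
        have hcorr := WilsonBlockHeatBath.abs_latticeConnectedCorr_le_two_mul r β (2 * L + 1)
          (A := fun V => r.curvature.F (cfgReflect V)) (B := r.curvature.F) (fun V => hCP _) hCP D
        calc (D : ℝ) ^ 8 * |latticeConnectedCorr r.ρ β (2 * L + 1)
              (fun V => r.curvature.F (cfgReflect V)) r.curvature.F D|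
            ≤ 1 * (2 * (CP * CP)) := mul_le_mul hD hcorr (abs_nonneg _) zero_le_one
          _ = 2 * (CP * CP) := one_mul _
    · exact ⟨(PairCeiling.pow_mul_abs_mirrorIn_le r (hpair β L hβ₀ hfem) hD2 hDL).trans
          ((le_max_right _ _).trans (le_max_right _ _)),
        (PairCeiling.pow_mul_abs_mirrorOut_le r (hpair β L hβ₀ hfem) hD2 hDL).trans
          ((le_max_right _ _).trans (le_max_right _ _))⟩
  · -- infrared corner
    have h := hIRc β hβ₂ L D hL hDL hIR
    exact ⟨h.1.trans (le_max_left _ _), h.2.1.trans (le_max_left _ _)⟩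

end Summit.QuantumFields.YangMills.Theorems.TunedSequenceExists.MirrorInfrared

end
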